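import Summits.AtomisticToContinuum.Crystallization.Theorems.SquareWellLayerCakeGapTwelveToBarlowCombinatorialLayeringDevelopFinal
import Summits.AtomisticToContinuum.Crystallization.Theorems.SquareWellLayerCakeGapTwelveToBarlowCombinatorialLayeringOfParts

/-!
# Combinatorial layering (B1a of `GapTwelveToBarlow`): the assembly with an existential window constant (recommended v7 shape)

Crux `SquareWellLayerCake.GapTwelveToBarlow` (stmt-AtomisticToContinuum-15807), line `Sketch`.
The wave-5 budget finding (report `develop-REPORT-w5.md`) makes the window constant of
`stub_develop` / `stub_combinatorialLayering` EXISTENTIAL (`∃ C D₀`).  This file is the typed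
assembly in that shape:
* `stub_combinatorialLayering_of_parts_v7 : (S3δ) → (H_develop, ∃-window) → (GAP → stub, ∃-window)`
  (the `2·D'` chart lemmas at `D' := C·D/2`);
* `stub_combinatorialLayering_v7_of_stubs : (S3δ) → (GoodFacets) → (H_inj) → (GAP → stub, ∃-window)`
  through `develop_of_goodFacets_of_inj` — i.e. B1a modulo the census `stub_linkCensus`, the facet
  stub `stub_goodFacets` and the one new residual H_inj (local injectivity of STAR/LINK developments).
Anchor: `charts_window_half` (the window conversion).  Nothing is defined; no named fact is used.
-/

noncomputable section

namespace Summit.AtomisticToContinuum.Crystallization.Theorems.SquareWellLayerCakeGapTwelveToBarlow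

open Literature.Geometry.DiscreteGeometry Literature.MathematicalPhysics.StatisticalMechanics

/-- **Window conversion** (registered anchor of this file): `2 · (W/2) = W`. [folklore] -/
theorem charts_window_half :
    ∀ (W : ℝ) (d : ℝ), d ≤ W ↔ d ≤ 2 * (W / 2) := by
  intro W d; constructor <;> intro h <;> linarith

/-- **`stub_combinatorialLayering` (∃-window) from the census and H_develop (∃-window).** [folklore] -/
theorem stub_combinatorialLayering_of_parts_v7 :
    (∀ (N : ℕ) (x : Fin N → EuclideanSpace ℝ (Fin 3)) (j : Fin N), ((∀ j' : Fin N, dist (x j) (x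
    j') ≤ 11 / 10 → ∀ k' : Fin N, k' ≠ j' → (55 : ℝ) / 57 ≤ dist (x j') (x k')) ∧
    (Finset.univ.filter fun j' : Fin N => j' ≠ j ∧ dist (x j) (x j') ≤ 1).card = 12 ∧
    (Finset.univ.filter fun j' : Fin N => j' ≠ j ∧ dist (x j) (x j') ≤ 11 / 10).card ≤ 12) → (∀
    l l' : Fin N, dist (x j) (x l) ≤ 1 → dist (x j) (x l') ≤ 1 → 1 < dist (x l) (x l') → (131 :
    ℝ) / 100 ≤ dist (x l) (x l')) → ∃ e : Fin 12 → Fin N, Function.Injective e ∧ (∀ a : Fin 12,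
    e a ≠ j ∧ dist (x j) (x (e a)) ≤ 1) ∧ ((∀ a b : Fin 12, a ≠ b → (dist (x (e a)) (x (e b)) ≤
    1 ↔ Literature.Geometry.DiscreteGeometry.fccAdj a b)) ∨ (∀ a b : Fin 12, a ≠ b → (dist (x (e
    a)) (x (e b)) ≤ 1 ↔ Literature.Geometry.DiscreteGeometry.hcpAdj a b)) ∨ (∀ a b : Fin 12, a ≠
    b → (dist (x (e a)) (x (e b)) ≤ 1 ↔
    Summit.AtomisticToContinuum.Crystallization.Theorems.SquareWellLayerCakeGapTwelveToBarlow.bppAdj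
    a b = true)))) → (∃ C D₀ : ℝ, ∀ (N : ℕ) (x : Fin N → EuclideanSpace ℝ (Fin 3)) (i : Fin N)
    (D : ℝ), D₀ ≤ D → (∀ j : Fin N, dist (x i) (x j) ≤ C * D → ((∀ j' : Fin N, dist (x j) (x j')
    ≤ 11 / 10 → ∀ k : Fin N, k ≠ j' → (55 : ℝ) / 57 ≤ dist (x j') (x k)) ∧ (Finset.univ.filter
    fun j' : Fin N => j' ≠ j ∧ dist (x j) (x j') ≤ 1).card = 12 ∧ (Finset.univ.filter fun j' :
    Fin N => j' ≠ j ∧ dist (x j) (x j') ≤ 11 / 10).card ≤ 12)) → (∀ j k : Fin N, dist (x i) (x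
    j) ≤ C * D → ¬ (j ≠ k ∧ dist (x j) (x k) ≤ 1 ∧ (Finset.univ.filter fun l : Fin N => l ≠ j ∧
    l ≠ k ∧ dist (x j) (x l) ≤ 1 ∧ dist (x k) (x l) ≤ 1).card = 5)) → (∀ j : Fin N, dist (x i)
    (x j) + 10 ≤ C * D → ∃ (T : Fin 12 → Fin 3 → ℤ) (e : Fin 12 → Fin N), ((((T = fun a : Fin 12
    => 3 • Literature.Geometry.DiscreteGeometry.fccTab a) ∨ T =
    Literature.Geometry.DiscreteGeometry.hcpTab) ∧ Function.Injective e ∧ (∀ a : Fin 12, e a ≠ j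
    ∧ dist (x j) (x (e a)) ≤ 1) ∧ (∀ k : Fin N, k ≠ j → dist (x j) (x k) ≤ 1 → ∃ a : Fin 12, e a
    = k) ∧ (∀ a b : Fin 12, a ≠ b → (dist (x (e a)) (x (e b)) ≤ 1 ↔
    Literature.Geometry.DiscreteGeometry.sqNormInt (T a - T b) = 18))))) → (∀ (j j' : Fin N) (T
    T' : Fin 12 → Fin 3 → ℤ) (e e' : Fin 12 → Fin N), dist (x i) (x j) + 10 ≤ C * D → dist (x i)
    (x j') + 10 ≤ C * D → j ≠ j' → dist (x j) (x j') ≤ 1 → ((((T = fun a : Fin 12 => 3 •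
    Literature.Geometry.DiscreteGeometry.fccTab a) ∨ T =
    Literature.Geometry.DiscreteGeometry.hcpTab) ∧ Function.Injective e ∧ (∀ a : Fin 12, e a ≠ j
    ∧ dist (x j) (x (e a)) ≤ 1) ∧ (∀ k : Fin N, k ≠ j → dist (x j) (x k) ≤ 1 → ∃ a : Fin 12, e a
    = k) ∧ (∀ a b : Fin 12, a ≠ b → (dist (x (e a)) (x (e b)) ≤ 1 ↔
    Literature.Geometry.DiscreteGeometry.sqNormInt (T a - T b) = 18)))) → ((((T' = fun a : Fin
    12 => 3 • Literature.Geometry.DiscreteGeometry.fccTab a) ∨ T' =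
    Literature.Geometry.DiscreteGeometry.hcpTab) ∧ Function.Injective e' ∧ (∀ a : Fin 12, e' a ≠
    j' ∧ dist (x j') (x (e' a)) ≤ 1) ∧ (∀ k : Fin N, k ≠ j' → dist (x j') (x k) ≤ 1 → ∃ a : Fin
    12, e' a = k) ∧ (∀ a b : Fin 12, a ≠ b → (dist (x (e' a)) (x (e' b)) ≤ 1 ↔
    Literature.Geometry.DiscreteGeometry.sqNormInt (T' a - T' b) = 18)))) → ∀ a a' b b' : Fin
    12, e a = e' b → e a' = e' b' → Literature.Geometry.DiscreteGeometry.sqNormInt (T a - T a')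
    = Literature.Geometry.DiscreteGeometry.sqNormInt (T' b - T' b')) → ∃ s : ℤ → ℤ, IsHaggSeq s
    ∧ ∃ φ : Fin N → EuclideanSpace ℝ (Fin 3), (∀ j : Fin N, dist (x i) (x j) ≤ D → φ j ∈
    barlowStacking 1 (Real.sqrt (2 / 3)) s) ∧ (∀ j j' : Fin N, dist (x i) (x j) ≤ D → dist (x i)
    (x j') ≤ D → j ≠ j' → φ j ≠ φ j') ∧ (∀ j j' : Fin N, dist (x i) (x j) ≤ D → dist (x i) (x
    j') ≤ D → j ≠ j' → (dist (x j) (x j') ≤ 1 ↔ dist (φ j) (φ j') = 1)) ∧ (∀ p ∈ barlowStacking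
    1 (Real.sqrt (2 / 3)) s, dist p (φ i) ≤ D / 2 → ∃ j : Fin N, dist (x i) (x j) ≤ D ∧ φ j =
    p)) → ((∀ (N : ℕ) (x : Fin N → EuclideanSpace ℝ (Fin 3)) (i j : Fin N), (∀ l : Fin N, dist
    (x i) (x l) ≤ 4 → ((∀ j' : Fin N, dist (x l) (x j') ≤ 11 / 10 → ∀ k : Fin N, k ≠ j' → (55 :
    ℝ) / 57 ≤ dist (x j') (x k)) ∧ (Finset.univ.filter fun j' : Fin N => j' ≠ l ∧ dist (x l) (x
    j') ≤ 1).card = 12 ∧ (Finset.univ.filter fun j' : Fin N => j' ≠ l ∧ dist (x l) (x j') ≤ 11 /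
    10).card ≤ 12)) → 1 < dist (x i) (x j) → (131 : ℝ) / 100 ≤ dist (x i) (x j)) → ∃ C D₀ : ℝ, ∀
    (N : ℕ) (x : Fin N → EuclideanSpace ℝ (Fin 3)) (i : Fin N) (D : ℝ), D₀ ≤ D → (∀ j : Fin N,
    dist (x i) (x j) ≤ C * D → ((∀ j' : Fin N, dist (x j) (x j') ≤ 11 / 10 → ∀ k : Fin N, k ≠ j'
    → (55 : ℝ) / 57 ≤ dist (x j') (x k)) ∧ (Finset.univ.filter fun j' : Fin N => j' ≠ j ∧ dist
    (x j) (x j') ≤ 1).card = 12 ∧ (Finset.univ.filter fun j' : Fin N => j' ≠ j ∧ dist (x j) (x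
    j') ≤ 11 / 10).card ≤ 12)) → (∀ j k : Fin N, dist (x i) (x j) ≤ C * D → ¬ (j ≠ k ∧ dist (x
    j) (x k) ≤ 1 ∧ (Finset.univ.filter fun l : Fin N => l ≠ j ∧ l ≠ k ∧ dist (x j) (x l) ≤ 1 ∧
    dist (x k) (x l) ≤ 1).card = 5)) → ∃ s : ℤ → ℤ, IsHaggSeq s ∧ ∃ φ : Fin N → EuclideanSpace ℝ
    (Fin 3), (∀ j : Fin N, dist (x i) (x j) ≤ D → φ j ∈ barlowStacking 1 (Real.sqrt (2 / 3)) s)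
    ∧ (∀ j j' : Fin N, dist (x i) (x j) ≤ D → dist (x i) (x j') ≤ D → j ≠ j' → φ j ≠ φ j') ∧ (∀
    j j' : Fin N, dist (x i) (x j) ≤ D → dist (x i) (x j') ≤ D → j ≠ j' → (dist (x j) (x j') ≤ 1
    ↔ dist (φ j) (φ j') = 1)) ∧ (∀ p ∈ barlowStacking 1 (Real.sqrt (2 / 3)) s, dist p (φ i) ≤ D
    / 2 → ∃ j : Fin N, dist (x i) (x j) ≤ D ∧ φ j = p)) :=
  fun hCensus hdev hGap => by
    obtain ⟨C, D₀, hD⟩ := hdev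
    refine ⟨C, D₀, fun N x i D hD₀ hGood hFF => hD N x i D hD₀ hGood hFF ?_ ?_⟩
    · intro j hj
      exact zchart_of_deep hGap hCensus N x i (C * D / 2) (fun j hj => hGood j (by linarith))
        (fun j k hj => hFF j k (by linarith)) j (by linarith)
    · intro j j' T T' e e' hj hj' hne hb hc hc'
      exact transfers_of_deep hGap lens_five_points N x i (C * D / 2)
        (fun j hj => hGood j (by linarith)) j j' T T' e e' (by linarith) (by linarith) hne hb hc hc'

/-- **B1a modulo three closed statements**: the census `(S3δ)`, `(GoodFacets)` and the
injectivity residual `(H_inj)` give `stub_combinatorialLayering` with an existential window.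
[folklore] -/
theorem stub_combinatorialLayering_v7_of_stubs :
    (∀ (N : ℕ) (x : Fin N → EuclideanSpace ℝ (Fin 3)) (j : Fin N), ((∀ j' : Fin N, dist (x j) (x
    j') ≤ 11 / 10 → ∀ k' : Fin N, k' ≠ j' → (55 : ℝ) / 57 ≤ dist (x j') (x k')) ∧
    (Finset.univ.filter fun j' : Fin N => j' ≠ j ∧ dist (x j) (x j') ≤ 1).card = 12 ∧
    (Finset.univ.filter fun j' : Fin N => j' ≠ j ∧ dist (x j) (x j') ≤ 11 / 10).card ≤ 12) → (∀
    l l' : Fin N, dist (x j) (x l) ≤ 1 → dist (x j) (x l') ≤ 1 → 1 < dist (x l) (x l') → (131 :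
    ℝ) / 100 ≤ dist (x l) (x l')) → ∃ e : Fin 12 → Fin N, Function.Injective e ∧ (∀ a : Fin 12,
    e a ≠ j ∧ dist (x j) (x (e a)) ≤ 1) ∧ ((∀ a b : Fin 12, a ≠ b → (dist (x (e a)) (x (e b)) ≤
    1 ↔ Literature.Geometry.DiscreteGeometry.fccAdj a b)) ∨ (∀ a b : Fin 12, a ≠ b → (dist (x (e
    a)) (x (e b)) ≤ 1 ↔ Literature.Geometry.DiscreteGeometry.hcpAdj a b)) ∨ (∀ a b : Fin 12, a ≠
    b → (dist (x (e a)) (x (e b)) ≤ 1 ↔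
    Summit.AtomisticToContinuum.Crystallization.Theorems.SquareWellLayerCakeGapTwelveToBarlow.bppAdj
    a b = true)))) → (∀ (N : ℕ) (x : Fin N → EuclideanSpace ℝ (Fin 3)) (i : Fin N), (∀ l : Fin
    N, dist (x i) (x l) ≤ 4 → ((∀ j' : Fin N, dist (x l) (x j') ≤ 11 / 10 → ∀ k : Fin N, k ≠ j'
    → (55 : ℝ) / 57 ≤ dist (x j') (x k)) ∧ (Finset.univ.filter fun j' : Fin N => j' ≠ l ∧ dist
    (x l) (x j') ≤ 1).card = 12 ∧ (Finset.univ.filter fun j' : Fin N => j' ≠ l ∧ dist (x l) (x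
    j') ≤ 11 / 10).card ≤ 12)) → ∀ (n : EuclideanSpace ℝ (Fin 3)) (a b c : Fin N), (∀ l : Fin N,
    l ≠ i → dist (x i) (x l) ≤ 1 → inner ℝ n (x l - x i) ≤ 1) → a ≠ i → b ≠ i → c ≠ i → a ≠ b →
    b ≠ c → a ≠ c → dist (x i) (x a) ≤ 1 → dist (x i) (x b) ≤ 1 → dist (x i) (x c) ≤ 1 → inner ℝ
    n (x a - x i) = 1 → inner ℝ n (x b - x i) = 1 → inner ℝ n (x c - x i) = 1 → (dist (x a) (x
    b) ≤ 1 ∧ dist (x b) (x c) ≤ 1) ∨ (dist (x b) (x c) ≤ 1 ∧ dist (x c) (x a) ≤ 1) ∨ (dist (x c)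
    (x a) ≤ 1 ∧ dist (x a) (x b) ≤ 1)) → (∀ (N : ℕ) (x : Fin N → EuclideanSpace ℝ (Fin 3)) (s :
    ℤ → ℤ) (Φ : EuclideanSpace ℝ (Fin 3) → Fin N) (c : EuclideanSpace ℝ (Fin 3)) (ρ : ℝ),
    IsHaggSeq s → c ∈ barlowStacking 1 (Real.sqrt (2 / 3)) s → (∀ j : Fin N, dist (x (Φ c)) (x
    j) ≤ 3 * ρ + 6 → ((∀ j' : Fin N, dist (x j) (x j') ≤ 11 / 10 → ∀ k : Fin N, k ≠ j' → (55 :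
    ℝ) / 57 ≤ dist (x j') (x k)) ∧ (Finset.univ.filter fun j' : Fin N => j' ≠ j ∧ dist (x j) (x
    j') ≤ 1).card = 12 ∧ (Finset.univ.filter fun j' : Fin N => j' ≠ j ∧ dist (x j) (x j') ≤ 11 /
    10).card ≤ 12)) → (∀ p ∈ barlowStacking 1 (Real.sqrt (2 / 3)) s, dist p c ≤ ρ → ((∀ q ∈
    barlowStacking 1 (Real.sqrt (2 / 3)) s, dist p q = 1 → Φ q ≠ Φ p ∧ dist (x (Φ p)) (x (Φ q))
    ≤ 1) ∧ (∀ q ∈ barlowStacking 1 (Real.sqrt (2 / 3)) s, ∀ q' ∈ barlowStacking 1 (Real.sqrt (2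
    / 3)) s, dist p q = 1 → dist p q' = 1 → Φ q = Φ q' → q = q') ∧ (∀ l : Fin N, l ≠ Φ p → dist
    (x (Φ p)) (x l) ≤ 1 → ∃ q ∈ barlowStacking 1 (Real.sqrt (2 / 3)) s, dist p q = 1 ∧ Φ q = l)
    ∧ (∀ q ∈ barlowStacking 1 (Real.sqrt (2 / 3)) s, ∀ q' ∈ barlowStacking 1 (Real.sqrt (2 / 3))
    s, dist p q = 1 → dist p q' = 1 → q ≠ q' → (dist (x (Φ q)) (x (Φ q')) ≤ 1 ↔ dist q q' =
    1)))) → ∀ p ∈ barlowStacking 1 (Real.sqrt (2 / 3)) s, dist p c ≤ ρ / 2 → Φ p = Φ c → p = c)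
    → ((∀ (N : ℕ) (x : Fin N → EuclideanSpace ℝ (Fin 3)) (i j : Fin N), (∀ l : Fin N, dist (x i)
    (x l) ≤ 4 → ((∀ j' : Fin N, dist (x l) (x j') ≤ 11 / 10 → ∀ k : Fin N, k ≠ j' → (55 : ℝ) /
    57 ≤ dist (x j') (x k)) ∧ (Finset.univ.filter fun j' : Fin N => j' ≠ l ∧ dist (x l) (x j') ≤
    1).card = 12 ∧ (Finset.univ.filter fun j' : Fin N => j' ≠ l ∧ dist (x l) (x j') ≤ 11 /
    10).card ≤ 12)) → 1 < dist (x i) (x j) → (131 : ℝ) / 100 ≤ dist (x i) (x j)) → ∃ C D₀ : ℝ, ∀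
    (N : ℕ) (x : Fin N → EuclideanSpace ℝ (Fin 3)) (i : Fin N) (D : ℝ), D₀ ≤ D → (∀ j : Fin N,
    dist (x i) (x j) ≤ C * D → ((∀ j' : Fin N, dist (x j) (x j') ≤ 11 / 10 → ∀ k : Fin N, k ≠ j'
    → (55 : ℝ) / 57 ≤ dist (x j') (x k)) ∧ (Finset.univ.filter fun j' : Fin N => j' ≠ j ∧ dist
    (x j) (x j') ≤ 1).card = 12 ∧ (Finset.univ.filter fun j' : Fin N => j' ≠ j ∧ dist (x j) (x
    j') ≤ 11 / 10).card ≤ 12)) → (∀ j k : Fin N, dist (x i) (x j) ≤ C * D → ¬ (j ≠ k ∧ dist (x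
    j) (x k) ≤ 1 ∧ (Finset.univ.filter fun l : Fin N => l ≠ j ∧ l ≠ k ∧ dist (x j) (x l) ≤ 1 ∧
    dist (x k) (x l) ≤ 1).card = 5)) → ∃ s : ℤ → ℤ, IsHaggSeq s ∧ ∃ φ : Fin N → EuclideanSpace ℝ
    (Fin 3), (∀ j : Fin N, dist (x i) (x j) ≤ D → φ j ∈ barlowStacking 1 (Real.sqrt (2 / 3)) s)
    ∧ (∀ j j' : Fin N, dist (x i) (x j) ≤ D → dist (x i) (x j') ≤ D → j ≠ j' → φ j ≠ φ j') ∧ (∀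
    j j' : Fin N, dist (x i) (x j) ≤ D → dist (x i) (x j') ≤ D → j ≠ j' → (dist (x j) (x j') ≤ 1
    ↔ dist (φ j) (φ j') = 1)) ∧ (∀ p ∈ barlowStacking 1 (Real.sqrt (2 / 3)) s, dist p (φ i) ≤ D
    / 2 → ∃ j : Fin N, dist (x i) (x j) ≤ D ∧ φ j = p)) :=
  fun hCensus hGF hInj => stub_combinatorialLayering_of_parts_v7 hCensus
    (develop_of_goodFacets_of_inj hGF hInj)

end Summit.AtomisticToContinuum.Crystallization.Theorems.SquareWellLayerCakeGapTwelveToBarlow
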